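import Mathlib
import Literature.NumberTheory.LFunctions.Zhang2022.TypedAppendixA2
import Literature.NumberTheory.LFunctions.Zhang2022.Section15CalM1Ratio
import Literature.NumberTheory.LFunctions.Zhang2022.Section15CPrimeFactorPowerSum
import Literature.Analysis.Complex.HolomorphicProducts
import HarnessLib

/-!
# Zhang (2022), §15 Lemma 15.3 part 1 at the repaired normaliser (`Lemma153Rp`): the GLUE from the
# local Euler factors — continuation and the bound `C·e^{2𝓛^{1/10}}` from per-prime holomorphy, the
# repaired local estimate, and the `σ > 1` Euler identity, kernel-checked

Topic `Literature/NumberTheory/LFunctions/Zhang2022` (Landau–Siegel audit tree; verdict-neutral).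
Y. Zhang, *Discrete mean estimates and the Landau–Siegel zero*, arXiv:2211.02515v1 (2022)
[Zhang2022LandauSiegel], §15 Lemma 15.3 p. 87 and its Appendix-A sketch p. 105 (tex L5172–L5185),
**an unrefereed manuscript under adjudication; nothing here asserts or denies its Theorems 1–2.**

The leaf of record is `Typed.Section15C.Lemma153RpI c′` = `Lemma153Rp c′ inputs15AB`: (part 1) the
repaired `𝒰₁ⱼ` (`Section15C.calU1R`, normaliser `(ζ(s)²L(s−βⱼ,χ)²)⁻¹`, GAP row G-L4t3-1) continues
analytically to `Re s ≥ 9/10` with the `D`-dependent bound `‖U(s)‖ ≤ C·exp(2𝓛^{1/10})`, and (part 2)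
its value at `1` (`Step15_u053R`). The Appendix-A sketch reaches part 1 through the Euler product
`𝒰₁ⱼ(s) = ∏_q 𝔲ᴿ₁ⱼ(q,s)` (`Typed.AppendixA2.frakU1FactorR`, node `StepA_u030R`), a local estimate for
`(q,D) = 1` (row G-d52-1: the printed `1 + O(q^{−2σ})` is false at `χ(q) = −1`; the repaired-in-cone
form is `‖𝔲ᴿ₁ⱼ(q,s) − 1‖ ≤ C(q^{−2σ} + q^{−1−σ})`), and, for `q ∣ D`, the exact factor `(1 − q^{−s})²`
(as `χ(q) = 0` and `ϖ₁ⱼ(1) = 1`, tree `Typed.Section15B.inline15_varpiMult_holds`), whose product over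
`q ∣ D` is `≤ C·e^{2𝓛^{1/10}}` on `Re s ≥ 9/10` (tree `Typed.Section15C.prod_primeFactors_one_add_rpow_sq_le`).

This file PROVES the glue (theorems only, no definitions, no facts):

* `frakU1FactorR_eq_of_dvd_of_varpi1_one` — for `q ∣ D` and `ϖ₁ⱼ(1) = 1`:
  `𝔲ᴿ₁ⱼ(q,s) = (1 − q^{−s})²`;
* **`lemma153Rp_part1_of_local`** — part 1 of `Lemma153Rp c′ inputs15AB` FROM the hypothesis
  (H) `∃ C, ForAllLarge, (A) → ∀ j ∈ {1,2,3}, ∀ q prime, s ↦ 𝔲ᴿ₁ⱼ(q,s) holomorphic on σ > 17/20 ∧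
  ((q,D) = 1 → ‖𝔲ᴿ₁ⱼ(q,s) − 1‖ ≤ C(q^{−2σ} + q^{−1−σ}) on σ > 17/20)` and `StepA_u030R c′`:
  `U := ∏'_q 𝔲ᴿ₁ⱼ(q,·)` is holomorphic on the open half-plane `σ > 17/20` (Weierstrass `M`-test for
  products, `Literature.Analysis.Complex.differentiableOn_tprod_of_norm_sub_one_le`, majorant
  `2C q^{−17/10} + 3·[q ∣ D]`), hence analytic on `Re s ≥ 9/10`; equals `calU1R` on `σ > 1` by u030R;
  and every finite partial product on `Re s ≥ 9/10` is bounded by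
  `∏_{q∣D}(1 + q^{−9/10})² · exp(Σ_q 2C q^{−17/10}) ≤ C′e^{2𝓛^{1/10}}`
  (`Literature.Analysis.Complex.norm_tprod_le_of_forall_norm_prod_le`);
* `lemma153RpI_of_local` — with `Step15_u053R c′ inputs15AB` added, the leaf `Lemma153RpI c′`.

So the leaf `h153RpI` is reduced to three local statements: per-prime holomorphy + the G-d52-1 bound,
the Euler identity `StepA_u030R`, and the value `Step15_u053R` (the claimant zl-w15-p7's items).
Any `σ₀ < 9/10` in place of `17/20` would do. WHAT THIS IS NOT: a proof of those three inputs, or of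
anything about Theorems 1–2 / Landau–Siegel zeros.

## References

* Y. Zhang, arXiv:2211.02515v1 (2022), §15 Lemma 15.3 p. 87; App. A p. 105 (tex L5172–L5185).
  [cite: Zhang2022LandauSiegel, §15 Lemma 15.3]
* J. B. Conway, *Functions of One Complex Variable I* (1978), VII.5. [cite: Conway1978, VII.5]
-/

noncomputable section

open Complex Real Filter Topology Finset

namespace Literature.NumberTheory.LFunctions.Zhang2022.Typed.Section15C

open Literature.NumberTheory.LFunctions.Zhang2022
open Literature.NumberTheory.LFunctions.Zhang2022.Skeleton
open Literature.NumberTheory.LFunctions.Zhang2022.Typed.Section15B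
open Literature.NumberTheory.LFunctions.Zhang2022.Typed.AppendixA2

/-! ## The factors at the primes dividing `D` -/

/-- For a prime `q ∣ D`, `χ(q^r) = 0` for `r ≥ 1`. [folklore] -/
private theorem chi_prime_pow_eq_zero {D : ℕ} (χ : DirichletCharacter ℂ D) {q : ℕ} (hq : q.Prime)
    (hqD : q ∣ D) {r : ℕ} (hr : r ≠ 0) : χ ((q ^ r : ℕ) : ZMod D) = 0 := by
  apply χ.map_nonunit
  rw [ZMod.isUnit_iff_coprime]
  intro hcop
  have h1 : Nat.Coprime q D := Nat.Coprime.coprime_dvd_left (dvd_pow_self q hr) hcop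
  exact (Nat.Prime.dvd_iff_not_coprime hq).1 hqD h1

/-- **The repaired Euler factor at a prime `q ∣ D` is `(1 − q^{−s})²`** once `ϖ₁ⱼ(1) = 1`
(`χ(q) = 0` kills `(1 − χ(q)q^{−(s−βⱼ)})²` and every `r ≥ 1` term of the local series; the `r = 0`
term is `ϖ₁ⱼ(1)`). [cite: Zhang2022LandauSiegel, App. A p. 105, tex L5178] -/
theorem frakU1FactorR_eq_of_dvd_of_varpi1_one (c' : ℝ) {D : ℕ} [NeZero D]
    (χ : DirichletCharacter ℂ D) (j : ℕ) {q : ℕ} (hq : q.Prime) (hqD : q ∣ D)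
    (h1 : varpi1 c' χ j 1 = 1) (s : ℂ) :
    frakU1FactorR c' χ j q s = (1 - (q : ℂ) ^ (-s)) ^ 2 := by
  have hχ : χ (q : ZMod D) = 0 := by
    have := chi_prime_pow_eq_zero χ hq hqD (r := 1) one_ne_zero
    simpa using this
  have hser : (∑' r : ℕ, χ ((q ^ r : ℕ) : ZMod D) * (((q ^ r).divisors.card : ℕ) : ℂ) *
      varpi1 c' χ j (q ^ r) / (q : ℂ) ^ ((r : ℂ) * s)) = 1 := by
    rw [tsum_eq_single 0]
    · simp [h1]
    · intro r hr
      rw [chi_prime_pow_eq_zero χ hq hqD hr]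
      simp
  unfold frakU1FactorR
  rw [hχ, hser]
  simp

/-- `‖(1 − q^{−s})² − 1‖ ≤ 3` for `σ ≥ 0` (`|q^{−s}| ≤ 1`). [folklore] -/
private theorem norm_one_sub_cpow_sq_sub_one_le {q : ℕ} (hq : q.Prime) {s : ℂ} (hs : 0 ≤ s.re) :
    ‖(1 - (q : ℂ) ^ (-s)) ^ 2 - 1‖ ≤ 3 := by
  have hq1 : (1 : ℝ) ≤ q := by exact_mod_cast hq.one_lt.le
  have hX : ‖(q : ℂ) ^ (-s)‖ ≤ 1 := by
    rw [Complex.norm_natCast_cpow_of_pos hq.pos, Complex.neg_re]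
    exact Real.rpow_le_one_of_one_le_of_nonpos hq1 (by linarith)
  set X : ℂ := (q : ℂ) ^ (-s) with hXdef
  have e : (1 - X) ^ 2 - 1 = X * (X - 2) := by ring
  rw [e, norm_mul]
  have h2 : ‖X - 2‖ ≤ 3 := by
    calc ‖X - 2‖ ≤ ‖X‖ + ‖(2 : ℂ)‖ := norm_sub_le _ _
      _ ≤ 1 + 2 := by
          have : ‖(2 : ℂ)‖ = 2 := by simp
          rw [this]; linarith
      _ = 3 := by norm_num
  calc ‖X‖ * ‖X - 2‖ ≤ 1 * 3 := mul_le_mul hX h2 (norm_nonneg _) (by norm_num)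
    _ = 3 := by norm_num

/-- `‖1 − q^{−s}‖ ≤ 1 + q^{−9/10}` for `Re s ≥ 9/10`. [folklore] -/
private theorem norm_one_sub_cpow_le {q : ℕ} (hq : q.Prime) {s : ℂ} (hs : 9 / 10 ≤ s.re) :
    ‖1 - (q : ℂ) ^ (-s)‖ ≤ 1 + (q : ℝ) ^ (-(9 / 10 : ℝ)) := by
  have hq1 : (1 : ℝ) ≤ q := by exact_mod_cast hq.one_lt.le
  calc ‖1 - (q : ℂ) ^ (-s)‖ ≤ ‖(1 : ℂ)‖ + ‖(q : ℂ) ^ (-s)‖ := norm_sub_le _ _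
    _ ≤ 1 + (q : ℝ) ^ (-(9 / 10 : ℝ)) := by
        rw [norm_one, Complex.norm_natCast_cpow_of_pos hq.pos, Complex.neg_re]
        exact add_le_add le_rfl (Real.rpow_le_rpow_of_exponent_le hq1 (by linarith))

/-! ## Real-analysis helpers -/

/-- Products of reals over a sub-finset: factors `≥ 0` on `s` and `≥ 1` on `t ∖ s` give `∏_s f ≤ ∏_t f`.
[folklore] -/
private theorem prod_le_prod_of_subset_real {ι : Type*} [DecidableEq ι] {s t : Finset ι} (f : ι → ℝ)
    (hst : s ⊆ t) (hs : ∀ i ∈ s, 0 ≤ f i) (ht : ∀ i ∈ t, i ∉ s → 1 ≤ f i) :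
    ∏ i ∈ s, f i ≤ ∏ i ∈ t, f i := by
  rw [← Finset.prod_sdiff hst]
  have h1 : (1 : ℝ) ≤ ∏ i ∈ t \ s, f i := by
    rw [← Finset.prod_const_one (s := t \ s)]
    refine Finset.prod_le_prod (fun _ _ => zero_le_one) fun i hi => ?_
    exact ht i (Finset.mem_sdiff.mp hi).1 (Finset.mem_sdiff.mp hi).2
  have h0 : 0 ≤ ∏ i ∈ s, f i := Finset.prod_nonneg hs
  exact le_mul_of_one_le_left h0 h1

/-- `∏_{i∈A}(1 + x_i) ≤ exp(Σ_{i∈A} x_i)` for `x_i ≥ 0`. [folklore] -/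
private theorem prod_one_add_le_exp_sum {ι : Type*} (A : Finset ι) (x : ι → ℝ)
    (hx : ∀ i ∈ A, 0 ≤ x i) : ∏ i ∈ A, (1 + x i) ≤ Real.exp (∑ i ∈ A, x i) := by
  rw [Real.exp_sum]
  exact Finset.prod_le_prod (fun i hi => by linarith [hx i hi]) fun i _ => by
    linarith [Real.add_one_le_exp (x i)]

/-! ## The glue: Lemma 15.3 part 1 (repaired) from the local inputs -/

/-- **Lemma 15.3, part 1, at the repaired normaliser — from the local Euler factors** (App. A p. 105,
tex L5172–L5185, with the repaired-in-cone local statement of row G-d52-1). HYPOTHESES: (H) for all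
large `D`, under (A), for `1 ≤ j ≤ 3` and every prime `q`, `s ↦ 𝔲ᴿ₁ⱼ(q,s)` (`frakU1FactorR`) is
holomorphic on `σ > 17/20` and, when `q ∤ D`, `‖𝔲ᴿ₁ⱼ(q,s) − 1‖ ≤ C(q^{−2σ} + q^{−1−σ})` there; and
`StepA_u030R c′` (`𝒰₁ⱼ = ∏_q 𝔲ᴿ₁ⱼ(q,·)` on `σ > 1`). CONCLUSION: the first conjunct of
`Lemma153Rp c′ inputs15AB` — an analytic continuation `U` of `calU1R` to `Re s ≥ 9/10` with
`‖U(s)‖ ≤ C′·exp(2𝓛^{1/10})` there. Proof: `U = ∏'_q 𝔲ᴿ₁ⱼ(q,·)`; the factors at `q ∣ D` are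
`(1 − q^{−s})²` (`ϖ₁ⱼ(1) = 1`, `inline15_varpiMult_holds`); `M`-test with the summable majorant
`2C q^{−17/10} + 3[q ∣ D]`; partial products on `Re s ≥ 9/10` are
`≤ ∏_{q∣D}(1 + q^{−9/10})²·exp(2Cζ(17/10)) ≤ C′e^{2𝓛^{1/10}}` (`prod_primeFactors_one_add_rpow_sq_le`).
[cite: Zhang2022LandauSiegel, §15 Lemma 15.3 p. 87] -/
theorem lemma153Rp_part1_of_local (c' : ℝ)
    (hloc : ∃ C : ℝ, ForAllLarge fun D _ χ => AssumptionA D χ → ∀ j ∈ ({1, 2, 3} : Finset ℕ),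
      ∀ q : ℕ, q.Prime →
        DifferentiableOn ℂ (fun s => frakU1FactorR c' χ j q s) {s : ℂ | 17 / 20 < s.re} ∧
          (¬ q ∣ D → ∀ s : ℂ, 17 / 20 < s.re →
            ‖frakU1FactorR c' χ j q s - 1‖ ≤
              C * ((q : ℝ) ^ (-(2 * s.re)) + (q : ℝ) ^ (-(1 + s.re)))))
    (h30 : StepA_u030R c') :
    ∃ C : ℝ, ForAllLarge fun D _ χ => AssumptionA D χ → ∀ j ∈ ({1, 2, 3} : Finset ℕ),
      ∃ U : ℂ → ℂ, IsCalU1R c' inputs15AB χ j U ∧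
        ∀ s : ℂ, 9 / 10 ≤ s.re → ‖U s‖ ≤ C * Real.exp (2 * ell D ^ (1 / 10 : ℝ)) := by
  classical
  obtain ⟨C, hloc⟩ := hloc
  -- constants
  set C' : ℝ := max C 0 with hC'def
  have hC'0 : 0 ≤ C' := le_max_right _ _
  have hZsum : Summable fun n : ℕ => (n : ℝ) ^ (-(17 / 10 : ℝ)) :=
    Real.summable_nat_rpow.mpr (by norm_num)
  set Z : ℝ := ∑' n : ℕ, (n : ℝ) ^ (-(17 / 10 : ℝ)) with hZdef
  have hZ0 : 0 ≤ Z := tsum_nonneg fun n => Real.rpow_nonneg (Nat.cast_nonneg n) _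
  set CD : ℝ := Real.exp (20 * Real.exp ((10 ^ 10 + 1) / 10)) with hCDdef
  set Cfin : ℝ := CD * Real.exp (2 * C' * Z) with hCfindef
  refine ⟨Cfin, (hloc.and (inline15_varpiMult_holds c')).and h30 |>.mono
    fun D _ χ _ _ hS hA j hj => ?_⟩
  obtain ⟨⟨hlocD, hmult⟩, h30D⟩ := hS
  have hv1 : varpi1 c' χ j 1 = 1 := (hmult hA j hj).1
  have h30j := h30D hA j hj
  have hDpos : 0 < D := Nat.pos_of_ne_zero (NeZero.ne D)
  -- the factors and the open half-plane
  set O : Set ℂ := {s : ℂ | 17 / 20 < s.re} with hOdef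
  have hO : IsOpen O := isOpen_lt continuous_const Complex.continuous_re
  set F : Nat.Primes → ℂ → ℂ := fun q s => frakU1FactorR c' χ j (q : ℕ) s with hFdef
  have hFdvd : ∀ q : Nat.Primes, (q : ℕ) ∣ D → ∀ s : ℂ, F q s = (1 - ((q : ℕ) : ℂ) ^ (-s)) ^ 2 :=
    fun q hqD s => frakU1FactorR_eq_of_dvd_of_varpi1_one c' χ j q.prop hqD hv1 s
  -- the majorant
  set b : Nat.Primes → ℝ := fun q =>
    2 * C' * ((q : ℕ) : ℝ) ^ (-(17 / 10 : ℝ)) + (if (q : ℕ) ∣ D then 3 else 0) with hbdef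
  have hb0 : ∀ q, 0 ≤ b q := fun q => by
    simp only [hbdef]; split_ifs <;> positivity
  have hb1sum : Summable fun q : Nat.Primes => 2 * C' * ((q : ℕ) : ℝ) ^ (-(17 / 10 : ℝ)) :=
    (hZsum.comp_injective Subtype.val_injective).mul_left _
  set S₂ : Finset Nat.Primes := D.primeFactors.subtype Nat.Prime with hS₂def
  have hb2sum : Summable fun q : Nat.Primes => (if (q : ℕ) ∣ D then (3 : ℝ) else 0) := by
    refine summable_of_ne_finset_zero (s := S₂) fun q hq' => ?_
    have hndvd : ¬ (q : ℕ) ∣ D := fun h' =>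
      hq' (Finset.mem_subtype.mpr (Nat.mem_primeFactors.mpr ⟨q.prop, h', hDpos.ne'⟩))
    rw [if_neg hndvd]
  have hbsum : Summable b := hb1sum.add hb2sum
  -- the per-prime bounds on `O`
  have hFb : ∀ q : Nat.Primes, ∀ s ∈ O, ‖F q s - 1‖ ≤ b q := by
    intro q s hs
    have hs' : 17 / 20 < s.re := hs
    have hqp : (q : ℕ).Prime := q.prop
    have hq0 : (0 : ℝ) < ((q : ℕ) : ℝ) := by exact_mod_cast hqp.pos
    have hq1 : (1 : ℝ) ≤ ((q : ℕ) : ℝ) := by exact_mod_cast hqp.one_lt.le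
    have hnn : 0 ≤ 2 * C' * ((q : ℕ) : ℝ) ^ (-(17 / 10 : ℝ)) := by positivity
    by_cases hqD : (q : ℕ) ∣ D
    · have h3 := norm_one_sub_cpow_sq_sub_one_le hqp (s := s) (by linarith)
      rw [hFdvd q hqD s]
      simp only [hbdef, if_pos hqD]
      linarith
    · simp only [hbdef, if_neg hqD, add_zero, hFdef]
      have h := (hlocD hA j hj q hqp).2 hqD s hs'
      have e1 : ((q : ℕ) : ℝ) ^ (-(2 * s.re)) ≤ ((q : ℕ) : ℝ) ^ (-(17 / 10 : ℝ)) :=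
        Real.rpow_le_rpow_of_exponent_le hq1 (by linarith)
      have e2 : ((q : ℕ) : ℝ) ^ (-(1 + s.re)) ≤ ((q : ℕ) : ℝ) ^ (-(17 / 10 : ℝ)) :=
        Real.rpow_le_rpow_of_exponent_le hq1 (by linarith)
      have hsum0 : 0 ≤ ((q : ℕ) : ℝ) ^ (-(2 * s.re)) + ((q : ℕ) : ℝ) ^ (-(1 + s.re)) := by positivity
      calc ‖frakU1FactorR c' χ j q s - 1‖
          ≤ C * (((q : ℕ) : ℝ) ^ (-(2 * s.re)) + ((q : ℕ) : ℝ) ^ (-(1 + s.re))) := h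
        _ ≤ C' * (((q : ℕ) : ℝ) ^ (-(2 * s.re)) + ((q : ℕ) : ℝ) ^ (-(1 + s.re))) :=
            mul_le_mul_of_nonneg_right (le_max_left _ _) hsum0
        _ ≤ C' * (((q : ℕ) : ℝ) ^ (-(17 / 10 : ℝ)) + ((q : ℕ) : ℝ) ^ (-(17 / 10 : ℝ))) := by
            gcongr
        _ = 2 * C' * ((q : ℕ) : ℝ) ^ (-(17 / 10 : ℝ)) := by ring
  -- holomorphy of each factor and of the product on `O`
  have hFdiff : ∀ q : Nat.Primes, DifferentiableOn ℂ (F q) O :=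
    fun q => (hlocD hA j hj q q.prop).1
  have hUdiff : DifferentiableOn ℂ (fun s => ∏' q : Nat.Primes, F q s) O :=
    Literature.Analysis.Complex.differentiableOn_tprod_of_norm_sub_one_le hO hFdiff hbsum hFb
  set U : ℂ → ℂ := fun s => ∏' q : Nat.Primes, F q s with hUdef
  refine ⟨U, ⟨?_, ?_⟩, ?_⟩
  · -- analytic on `Re s ≥ 9/10 ⊆ O`
    have hsub : {s : ℂ | 9 / 10 ≤ s.re} ⊆ O := fun s hs => by
      have : 9 / 10 ≤ s.re := hs
      show 17 / 20 < s.re; linarith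
    exact (hUdiff.analyticOnNhd hO).mono hsub
  · -- agreement with `calU1R` on `σ > 1`
    intro s hs
    have h := h30j s hs
    show (∏' q : Nat.Primes, frakU1FactorR c' χ j (q : ℕ) s) = Section15C.calU1R c' inputs15AB χ j s
    exact h.symm
  · -- the bound on `Re s ≥ 9/10`
    intro s hs
    have hsO : s ∈ O := by show 17 / 20 < s.re; linarith
    -- the bound on every finite partial product
    have hCD : ∏ q ∈ D.primeFactors, (1 + (q : ℝ) ^ (-(9 / 10 : ℝ))) ^ 2 ≤
        CD * Real.exp (2 * Real.log D ^ (1 / 10 : ℝ)) := prod_primeFactors_one_add_rpow_sq_le D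
    have hB1 : 1 ≤ Cfin * Real.exp (2 * ell D ^ (1 / 10 : ℝ)) := by
      have h1 : 1 ≤ CD := Real.one_le_exp (by positivity)
      have h2 : 1 ≤ Real.exp (2 * C' * Z) := Real.one_le_exp (by positivity)
      have hℓ : 0 ≤ ell D := by rw [ell]; exact Real.log_natCast_nonneg D
      have h3 : 1 ≤ Real.exp (2 * ell D ^ (1 / 10 : ℝ)) :=
        Real.one_le_exp (by have := Real.rpow_nonneg hℓ (1 / 10 : ℝ); positivity)
      rw [hCfindef]
      calc (1 : ℝ) = 1 * 1 * 1 := by ring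
        _ ≤ CD * Real.exp (2 * C' * Z) * Real.exp (2 * ell D ^ (1 / 10 : ℝ)) := by
            gcongr
    refine Literature.Analysis.Complex.norm_tprod_le_of_forall_norm_prod_le (fun q => F q s) hB1
      fun A => ?_
    rw [Complex.norm_prod, ← Finset.prod_filter_mul_prod_filter_not A (fun q : Nat.Primes => (q : ℕ) ∣ D)]
    -- the `q ∣ D` part
    have hdvd_part : ∏ q ∈ A.filter (fun q : Nat.Primes => (q : ℕ) ∣ D), ‖F q s‖ ≤
        CD * Real.exp (2 * ell D ^ (1 / 10 : ℝ)) := by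
      have h1 : ∏ q ∈ A.filter (fun q : Nat.Primes => (q : ℕ) ∣ D), ‖F q s‖ ≤
          ∏ q ∈ A.filter (fun q : Nat.Primes => (q : ℕ) ∣ D),
            (1 + ((q : ℕ) : ℝ) ^ (-(9 / 10 : ℝ))) ^ 2 := by
        refine Finset.prod_le_prod (fun _ _ => norm_nonneg _) fun q hq => ?_
        have hqD : (q : ℕ) ∣ D := (Finset.mem_filter.mp hq).2
        rw [hFdvd q hqD s, norm_pow]
        exact pow_le_pow_left₀ (norm_nonneg _) (norm_one_sub_cpow_le q.prop hs) 2
      -- move to `ℕ` and enlarge to all prime factors of `D`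
      set g : ℕ → ℝ := fun n => (1 + (n : ℝ) ^ (-(9 / 10 : ℝ))) ^ 2 with hgdef
      have h2 : ∏ q ∈ A.filter (fun q : Nat.Primes => (q : ℕ) ∣ D),
          (1 + ((q : ℕ) : ℝ) ^ (-(9 / 10 : ℝ))) ^ 2 =
          ∏ n ∈ (A.filter (fun q : Nat.Primes => (q : ℕ) ∣ D)).map
            (Function.Embedding.subtype _), g n := by
        rw [Finset.prod_map]
        rfl
      have hsubset : (A.filter (fun q : Nat.Primes => (q : ℕ) ∣ D)).map
          (Function.Embedding.subtype _) ⊆ D.primeFactors := by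
        intro n hn
        obtain ⟨q, hq, rfl⟩ := Finset.mem_map.mp hn
        have hqD : (q : ℕ) ∣ D := (Finset.mem_filter.mp hq).2
        exact Nat.mem_primeFactors.mpr ⟨q.prop, hqD, hDpos.ne'⟩
      have h3 : ∏ n ∈ (A.filter (fun q : Nat.Primes => (q : ℕ) ∣ D)).map
            (Function.Embedding.subtype _), g n ≤ ∏ n ∈ D.primeFactors, g n :=
        prod_le_prod_of_subset_real g hsubset (fun n _ => by positivity) (fun n _ _ => by
          simp only [hgdef]
          have : 0 ≤ (n : ℝ) ^ (-(9 / 10 : ℝ)) := Real.rpow_nonneg (Nat.cast_nonneg n) _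
          nlinarith)
      calc ∏ q ∈ A.filter (fun q : Nat.Primes => (q : ℕ) ∣ D), ‖F q s‖
          ≤ ∏ n ∈ D.primeFactors, g n := h1.trans (h2 ▸ h3)
        _ ≤ CD * Real.exp (2 * Real.log D ^ (1 / 10 : ℝ)) := hCD
        _ = CD * Real.exp (2 * ell D ^ (1 / 10 : ℝ)) := by rw [ell]
    -- the `q ∤ D` part
    have hcop_part : ∏ q ∈ A.filter (fun q : Nat.Primes => ¬ (q : ℕ) ∣ D), ‖F q s‖ ≤
        Real.exp (2 * C' * Z) := by
      have h1 : ∏ q ∈ A.filter (fun q : Nat.Primes => ¬ (q : ℕ) ∣ D), ‖F q s‖ ≤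
          ∏ q ∈ A.filter (fun q : Nat.Primes => ¬ (q : ℕ) ∣ D),
            (1 + 2 * C' * ((q : ℕ) : ℝ) ^ (-(17 / 10 : ℝ))) := by
        refine Finset.prod_le_prod (fun _ _ => norm_nonneg _) fun q hq => ?_
        have hqD : ¬ (q : ℕ) ∣ D := (Finset.mem_filter.mp hq).2
        have hb := hFb q s hsO
        simp only [hbdef, if_neg hqD, add_zero] at hb
        calc ‖F q s‖ ≤ ‖F q s - 1‖ + ‖(1 : ℂ)‖ := by
              have := norm_add_le (F q s - 1) 1; rwa [sub_add_cancel] at this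
          _ ≤ 2 * C' * ((q : ℕ) : ℝ) ^ (-(17 / 10 : ℝ)) + 1 := by rw [norm_one]; linarith
          _ = 1 + 2 * C' * ((q : ℕ) : ℝ) ^ (-(17 / 10 : ℝ)) := by ring
      have h2 := prod_one_add_le_exp_sum (A.filter (fun q : Nat.Primes => ¬ (q : ℕ) ∣ D))
        (fun q : Nat.Primes => 2 * C' * ((q : ℕ) : ℝ) ^ (-(17 / 10 : ℝ))) (fun q _ => by positivity)
      have h3 : ∑ q ∈ A.filter (fun q : Nat.Primes => ¬ (q : ℕ) ∣ D),
          2 * C' * ((q : ℕ) : ℝ) ^ (-(17 / 10 : ℝ)) ≤ 2 * C' * Z := by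
        have h4 : ∑ q ∈ A.filter (fun q : Nat.Primes => ¬ (q : ℕ) ∣ D),
            2 * C' * ((q : ℕ) : ℝ) ^ (-(17 / 10 : ℝ)) ≤
            ∑' q : Nat.Primes, 2 * C' * ((q : ℕ) : ℝ) ^ (-(17 / 10 : ℝ)) :=
          hb1sum.sum_le_tsum _ (fun q _ => by positivity)
        have h5 : ∑' q : Nat.Primes, 2 * C' * ((q : ℕ) : ℝ) ^ (-(17 / 10 : ℝ)) ≤ 2 * C' * Z := by
          have h6 : ∑' q : Nat.Primes, ((q : ℕ) : ℝ) ^ (-(17 / 10 : ℝ)) ≤ Z :=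
            (hZsum.comp_injective Subtype.val_injective).tsum_le_tsum_of_inj
              (fun q : Nat.Primes => (q : ℕ)) Subtype.val_injective
              (fun n _ => Real.rpow_nonneg (Nat.cast_nonneg n) _) (fun q => le_rfl) hZsum
          rw [tsum_mul_left]
          exact mul_le_mul_of_nonneg_left h6 (by positivity)
        exact h4.trans h5
      exact h1.trans (h2.trans (Real.exp_le_exp.mpr h3))
    have hnn1 : 0 ≤ ∏ q ∈ A.filter (fun q : Nat.Primes => ¬ (q : ℕ) ∣ D), ‖F q s‖ :=
      Finset.prod_nonneg fun _ _ => norm_nonneg _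
    calc (∏ q ∈ A.filter (fun q : Nat.Primes => (q : ℕ) ∣ D), ‖F q s‖) *
          ∏ q ∈ A.filter (fun q : Nat.Primes => ¬ (q : ℕ) ∣ D), ‖F q s‖
        ≤ (CD * Real.exp (2 * ell D ^ (1 / 10 : ℝ))) * Real.exp (2 * C' * Z) :=
          mul_le_mul hdvd_part hcop_part hnn1 (by positivity)
      _ = Cfin * Real.exp (2 * ell D ^ (1 / 10 : ℝ)) := by rw [hCfindef]; ring

/-- **The leaf `h153RpI` from the local inputs**: (H) per-prime holomorphy on `σ > 17/20` + the
G-d52-1 local bound for `q ∤ D`, `StepA_u030R` (Euler identity on `σ > 1`) and `Step15_u053R` (the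
value at `1`) give `Typed.Section15C.Lemma153RpI c′` (= `Lemma153Rp c′ inputs15AB`).
[cite: Zhang2022LandauSiegel, §15 Lemma 15.3 p. 87] -/
theorem lemma153RpI_of_local (c' : ℝ)
    (hloc : ∃ C : ℝ, ForAllLarge fun D _ χ => AssumptionA D χ → ∀ j ∈ ({1, 2, 3} : Finset ℕ),
      ∀ q : ℕ, q.Prime →
        DifferentiableOn ℂ (fun s => frakU1FactorR c' χ j q s) {s : ℂ | 17 / 20 < s.re} ∧
          (¬ q ∣ D → ∀ s : ℂ, 17 / 20 < s.re →
            ‖frakU1FactorR c' χ j q s - 1‖ ≤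
              C * ((q : ℝ) ^ (-(2 * s.re)) + (q : ℝ) ^ (-(1 + s.re)))))
    (h30 : StepA_u030R c') (h53 : Step15_u053R c' inputs15AB) : Lemma153RpI c' :=
  ⟨lemma153Rp_part1_of_local c' hloc h30, h53⟩

end Literature.NumberTheory.LFunctions.Zhang2022.Typed.Section15C

end
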